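import Summits.BirchSwinnertonDyer.BirchSwinnertonDyer.Theses.SignedLowerHalves
import Summits.BirchSwinnertonDyer.Rank1Residual.Supersingular.KobayashiMainConjectureX7
import Summits.BirchSwinnertonDyer.Rank1Residual.Supersingular.TwistStability
import Summits.BirchSwinnertonDyer.Rank1Residual.Partition.MainConjecturesSignedLowerDivisibilityClasses
import Literature.NumberTheory.QuadraticFields.FundamentalDiscriminant
import HarnessLib

/-!
# Route `SignedLowerHalves`, crux `KobayashiLowerHalfLargeImage` (item stmt-BirchSwinnertonDyer-19001): the
# registered stub `stub_offFwLocus` on the BSTW-TWIST SUB-LOCUS, closed MODULO the tree's existing binder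
# `BurungaleSkinnerTianWan2024_thm13_twist_OPEN` (cell `bsd-ssimc`, seat `bsd-ssimc-k3-c3` gen 2; a
# `--supports … --as helper` file, closes nothing)

PARTITION (cell bsd-ssimc): X7 (A7) × the large-image branch OFF the Fouquet–Wan locus (277 of the 1 417
open X7 pairs of the cell window have surjective `ρ̄_{E,p}` and NO non-split multiplicative prime `ℓ ≠ p`
with `p ∤ ord_ℓ Δ_min`) — types-the-object-of; closes NONE. THEOREMS ONLY.

The line `birth` of crux 3 (planner g11, skeleton sha16 cce22a86407317b7) cuts the crux by the Fouquet–Wan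
locus; its second registered stub `stub_offFwLocus` (the complement) is recorded as «no engine in print».
That is inexact on one sub-family: Burungale–Skinner–Tian–Wan arXiv:2409.01350 Thm 1.3 carries a TWIST
CLAUSE — «the same holds for any quadratic twist `E^K := E ⊗ χ_K` … with discriminant coprime to `Np`
and divisible only by primes of ordinary reduction for `E`» (`E` semistable) — already typed in the tree as
the OPEN binder `Summit.BirchSwinnertonDyer.Rank1Residual.Supersingular.BurungaleSkinnerTianWan2024_thm13_twist_OPEN`
(`Supersingular/KobayashiMainConjectureX7.lean`, cell b2b; PRE, never a theorem). Such a twist `W` is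
additive exactly at the primes of `d_K` (type `I₀*`), keeps the multiplicative primes of `E₀` with `p ∤ d_K`,
and is OFF the Fouquet–Wan locus whenever none of those primes is non-split with `E[p]` ramified: census
(planner `census/fw_x7.tsv` × lev `census/x7census.tsv`, this seat): 14 of the 277 off-locus large-image
pairs meet the clause in the printed (intro) wording — 175910d1@3, 295027h1@3, 436825b1@3, 49126h1@5,
70707m1@5, 153054e1@5, 447678cx1@5, 488718h1@5, 394350cf1@7, 463650bj1@7, 352950cd1@11, 438450cj1@29,
106950ck1@107, 297990fa1@1319 (all of analytic rank 1) — and 2 more (392346l1@5, 100914p1@7) only in the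
body wording of BSTW Thm 2.1 (no ordinarity at the primes of `d_K`; not used here).

## What this file proves (namespace `Summit.BirchSwinnertonDyer.BirchSwinnertonDyer.Theorems`)

* `goodSS_and_frobeniusTrace_eq_zero_of_twistOfSemistable` — bookkeeping between the two tree
  transcriptions of the clause: the binder speaks of a quadratic FIELD `K` and twists by `d_K`
  (`NumberField.discr K`, which is `m` or `4m` with `m` square-free: tree
  `Quadratic.isFundamentalDiscriminant_discr`), the tree's twist-stability lemmas
  (`Supersingular/TwistStability.lean`) of a square-free `d`; for `W ≅ W₀^{(d_K)}` with `d_K` coprime to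
  `p ≠ 2`: `GoodSS W p → GoodSS W₀ p` and `a_p(W) = 0 → a_p(W₀) = 0` (the twist by `4m` is `ℚ`-isomorphic
  to the twist by `m`: `exists_variableChange_quadraticTwist_mul_sq`). So the clause's hypotheses on the
  semistable curve AT `p` («`p` supersingular for `E₀`», (h4) `a_3(E₀) = 0`) are discharged from the
  stub's hypotheses on `W` itself.
* `offFwLocus_kobayashiLowerDivisibility_of_BSTW13_twist_OPEN` — the registered stub `stub_offFwLocus`
  (hypotheses VERBATIM) PLUS the twist datum in the binder's own currency (`W₀` semistable, `K` quadratic,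
  `d_K` coprime to `N_{E₀}·p`, every prime of `d_K` good ordinary for `W₀`, `W ≅ W₀^{(d_K)}`) ⇒
  `∃ ε, KobayashiLowerDivisibility W p ε`, MODULO the one OPEN binder. `¬CM`, `Surj` and the off-locus
  hypothesis are carried unused (the clause needs none of them; `Surj` is automatic for such twists).
* `X7_bsdp_of_BSTW13_twist_OPEN_of_publishedSignedInputs_of_analyticRank_le_one` — for those pairs in
  analytic rank `≤ 1`: Miller's `BSD(E,p)` from the route's support item `PublishedSignedInputs` (the ten
  PUBLISHED named facts) by the class road `X7.bsdp_of_lowerDivisibility_of_surj`, MODULO the binder.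

HONEST STATUS: CONDITIONAL on an unrefereed preprint's twist clause (the cell's audit of BSTW Thm 1.3 —
REPORT-bstw-6/7, TARGET §3a — is for the semistable curve at `p ≥ 5` with scope rider (α); the twist clause
itself is read at statement level only, lev MEMO-1 L4); closes nothing; nothing is booked; the crux and
`stub_offFwLocus` stay OPEN on the ledger; BSD is not proved by any of this.

References: [BurungaleSkinnerTianWan2024] Thm 1.3 with twist clause (p. 3), §1.2.1 (h4); [Kobayashi2003]
Conjecture (p. 2), Thm 1.2, Thm 4.1; [Knapp1993] Prop. 12.10; [SilvermanAEC2009] VII.5 Prop. 5.1(a),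
X.5 Cor. 5.4; Marcus, Number Fields, Ch. 2 Thm 1 (`d_K = m` or `4m`).
-/

set_option autoImplicit false
set_option linter.dupNamespace false

noncomputable section

open scoped Classical

open WeierstrassCurve Literature.NumberTheory.EllipticCurves
  Literature.NumberTheory.EllipticCurves.Rank1Residual
  Summit.BirchSwinnertonDyer.Rank1Residual.Supersingular

namespace Summit.BirchSwinnertonDyer.BirchSwinnertonDyer.Theorems

/-- **The semistable curve of the twist clause is supersingular at `p` with `a_p = 0` as soon as the twist
is.** Let `W₀, W` be globally minimal, `p ≠ 2`, `K` a quadratic field with `d_K` coprime to `N·p`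
(only `p ∤ d_K` is used) and `C • W₀^{(d_K)} = W`. If `W` is good supersingular at `p` with `a_p(W) = 0`
then so is `W₀`: `d_K = m` or `4m` with `m` square-free (`isFundamentalDiscriminant_discr`), `W₀^{(4m)} ≅
W₀^{(m)}` over `ℚ` (`exists_variableChange_quadraticTwist_mul_sq`), and for a square-free twist unramified at
the odd prime `p` good supersingular reduction is twist-stable in both directions
(`goodSS_iff_of_smul_eq_quadraticTwist`) with `a_p(W) = (m/p)·a_p(W₀)`, `(m/p) = ±1`
(`frobeniusTrace_of_smul_eq_quadraticTwist`). [cite: Knapp1993, Prop. 12.10]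
[cite: SilvermanAEC2009, VII.5 Prop. 5.1(a) and X.5 Cor. 5.4] -/
theorem goodSS_and_frobeniusTrace_eq_zero_of_twistOfSemistable
    (W₀ : WeierstrassCurve ℚ) [W₀.IsElliptic] [W₀.IsGloballyMinimal]
    (W : WeierstrassCurve ℚ) [W.IsElliptic] [W.IsGloballyMinimal] (p : ℕ) [Fact p.Prime] (hp : p ≠ 2)
    (K : Type) [Field K] [NumberField K] (hK : Module.finrank ℚ K = 2) {n : ℤ}
    (hcop : IsCoprime (NumberField.discr K) (n * p))
    (hWd : ∃ C : VariableChange ℚ, C • W₀.quadraticTwist (NumberField.discr K : ℚ) = W)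
    (hss : GoodSS W p) (hap : W.frobeniusTrace p = 0) :
    GoodSS W₀ p ∧ W₀.frobeniusTrace p = 0 := by
  obtain ⟨C, hC⟩ := hWd
  have hpP : p.Prime := Fact.out
  have hpZ : Prime (p : ℤ) := Nat.prime_iff_prime_int.mp hpP
  -- `p ∤ d_K`
  have hpD : ¬ (p : ℤ) ∣ NumberField.discr K := by
    intro h
    have hu : IsUnit (p : ℤ) := hcop.isUnit_of_dvd' h (Dvd.intro_left n rfl)
    rw [Int.isUnit_iff_natAbs_eq, Int.natAbs_natCast] at hu
    exact hpP.ne_one hu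
  -- `p ∤ 2`
  have hp2 : ¬ (p : ℤ) ∣ 2 := by
    intro h2
    have : p ∣ 2 := by exact_mod_cast h2
    exact hp ((Nat.prime_dvd_prime_iff_eq hpP Nat.prime_two).mp this)
  -- a square-free `m` with `W ≅ W₀^{(m)}` over `ℚ` and `p ∤ 2m`
  have key : ∃ (m : ℤ) (C' : VariableChange ℚ), Squarefree m ∧
      C' • W = W₀.quadraticTwist (m : ℚ) ∧ ¬ (p : ℤ) ∣ 2 * m := by
    rcases Literature.NumberTheory.QuadraticFields.Quadratic.isFundamentalDiscriminant_discr hK with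
      ⟨-, hsq, -⟩ | ⟨h4, -, hsq⟩
    · refine ⟨NumberField.discr K, C⁻¹, hsq, ?_, ?_⟩
      · rw [← hC, inv_smul_smul]
      · intro h
        rcases hpZ.dvd_or_dvd h with h2 | hD
        · exact hp2 h2
        · exact hpD hD
    · obtain ⟨C₂, hC₂⟩ :=
        W₀.exists_variableChange_quadraticTwist_mul_sq ((NumberField.discr K / 4 : ℤ) : ℚ) 2 two_ne_zero
      have hD : NumberField.discr K = NumberField.discr K / 4 * 2 ^ 2 := by
        rw [show ((2 : ℤ) ^ 2) = 4 by norm_num, Int.ediv_mul_cancel h4]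
      have hDQ : (NumberField.discr K : ℚ) = ((NumberField.discr K / 4 : ℤ) : ℚ) * 2 ^ 2 := by
        exact_mod_cast hD
      refine ⟨NumberField.discr K / 4, (C * C₂)⁻¹, hsq, ?_, ?_⟩
      · rw [← hC, hDQ, ← hC₂, ← mul_smul C C₂, inv_smul_smul]
      · intro h
        rcases hpZ.dvd_or_dvd h with h2 | hm
        · exact hp2 h2
        · exact hpD (hD ▸ Dvd.dvd.mul_right hm _)
  obtain ⟨m, C', hm, hC', hp2m⟩ := key
  have hG : GoodSS W₀ p := (goodSS_iff_of_smul_eq_quadraticTwist W₀ W p hm hC' hp2m).mp hss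
  refine ⟨hG, ?_⟩
  have hform := frobeniusTrace_of_smul_eq_quadraticTwist W₀ W p hm hC' hp2m hG.1
  rw [hap] at hform
  rcases legendreSym_eq_one_or_of_not_dvd p hp2m with h | h
  · rw [h, one_mul] at hform
    exact hform.symm
  · rw [h, neg_one_mul, zero_eq_neg] at hform
    exact hform

/-- **`stub_offFwLocus` on the BSTW-twist sub-locus, MODULO the twist clause of BSTW Thm 1.3.** The
registered stub's hypotheses verbatim — `W` globally minimal, `p ≠ 2`, `ClassX7 W p`, `¬CM`, `a_p = 0`,
`ρ̄_{E,p}` onto, and NO prime `ℓ ≠ p` of non-split multiplicative reduction with `p ∤ ord_ℓ(Δ_min)` — PLUS the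
twist datum of the clause in the binder's own currency: `W₀` globally minimal and semistable, `K` a
quadratic field with `d_K` coprime to `N_{E₀}·p` and every prime of `d_K` good ordinary for `W₀`, and
`W ≅ W₀^{(d_K)}` over `ℚ`. IF `BurungaleSkinnerTianWan2024_thm13_twist_OPEN` holds (`hBSTW`, UNREFEREED)
then `∃ ε, KobayashiLowerDivisibility W p ε` (indeed the main conjecture for both signs). The clause's
conditions on `W₀` at `p` (supersingular; (h4) `a_3(W₀) = 0` at `p = 3`) are DISCHARGED from `ClassX7 W p`
and `a_p(W) = 0` (`goodSS_and_frobeniusTrace_eq_zero_of_twistOfSemistable`); `¬CM`, `Surj` and the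
off-locus hypothesis are carried unused. CONDITIONAL; closes nothing.
[claim: BurungaleSkinnerTianWan2024, status: under-review]
[cite: Kobayashi2003, Conjecture (Main Conjecture) (p. 2)] [cite: Knapp1993, Prop. 12.10] -/
theorem offFwLocus_kobayashiLowerDivisibility_of_BSTW13_twist_OPEN
    (hBSTW : BurungaleSkinnerTianWan2024_thm13_twist_OPEN)
    (W₀ : WeierstrassCurve ℚ) [W₀.IsElliptic] [W₀.IsGloballyMinimal]
    (K : Type) [Field K] [NumberField K] :
    ∀ (W : WeierstrassCurve ℚ) [W.IsElliptic] [W.IsGloballyMinimal] (p : ℕ) [Fact p.Prime],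
      p ≠ 2 → ClassX7 W p → ¬ W.HasCM → W.frobeniusTrace p = 0 → Surj W p →
      ¬ (∃ ℓ : ℕ, ∃ _ : Fact ℓ.Prime, ℓ ≠ p ∧ W.HasMultiplicativeReductionAtPrime ℓ ∧
          ¬ W.HasSplitMultiplicativeReductionAtPrime ℓ ∧ ¬ p ∣ padicValInt ℓ W.minimalDiscriminantInt) →
      Module.finrank ℚ K = 2 → Semistable W₀ →
      IsCoprime (NumberField.discr K) ((W₀.conductorNorm ℤ * p : ℕ) : ℤ) →
      (∀ (ℓ : ℕ) [Fact ℓ.Prime], (ℓ : ℤ) ∣ NumberField.discr K → GoodOrd W₀ ℓ) →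
      (∃ C : VariableChange ℚ, C • W₀.quadraticTwist (NumberField.discr K : ℚ) = W) →
      ∃ ε : ℤˣ, Summit.BirchSwinnertonDyer.Rank1Residual.Supersingular.KobayashiLowerDivisibility W p ε := by
  intro W _ _ p _ hp hX _hcm hap _hs _hoff hK hsst hcop hord hWd
  have hcop' : IsCoprime (NumberField.discr K) ((W₀.conductorNorm ℤ : ℤ) * p) := by
    simpa only [Nat.cast_mul] using hcop
  obtain ⟨hG₀, hap₀⟩ :=
    goodSS_and_frobeniusTrace_eq_zero_of_twistOfSemistable W₀ W p hp K hK hcop' hWd hX.1 hap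
  have h4 : p = 3 → W₀.frobeniusTrace 3 = 0 := by
    intro h3
    subst h3
    exact hap₀
  exact ⟨1, kobayashiLowerDivisibility_of_BSTW13_twist_OPEN W₀ p hBSTW hp hsst hG₀ h4 K hK hcop hord W
    hWd 1⟩

/-- **The BSTW-twist sub-locus of corner X7, analytic rank ≤ 1: `BSD(E,p)` MODULO the twist clause, from
the route's PUBLISHED inputs.** For `W ≅ W₀^{(d_K)}` as above lying in class X7 at the odd prime `p` with
`a_p = 0` and `ρ̄_{E,p}` onto, of analytic rank `≤ 1`: IF the twist clause (`hBSTW`, unrefereed) and the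
support item `PublishedSignedInputs` of route `SignedLowerHalves` (the conjunction of the ten PUBLISHED
named facts — Wuthrich 2014 Prop. 21, Kobayashi 2003 Thms 1.2/4.1, B. D. Kim 2013 Cor. 3.15, BKO 2024
Cor. A.5, the period relations, modularity, GZK) hold, then Miller's `BSDp W p`, by the class road
`X7.bsdp_of_lowerDivisibility_of_surj` (rank 0: Kobayashi–Kim–Pollack–Wuthrich; rank 1: BKO Cor. A.5).
All 14 census pairs are of analytic rank 1. CONDITIONAL; closes nothing.
[claim: BurungaleSkinnerTianWan2024, status: under-review] [cite: Kobayashi2003, Thm. 1.2 and Thm. 4.1 (p. 8)]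
[cite: BurungaleKobayashiOta2023, App. A Cor. A.5] [cite: Wuthrich2014, Prop. 21 (p. 400)]
[cite: Miller2011LMS, §1 and Def. 1.1] -/
theorem X7_bsdp_of_BSTW13_twist_OPEN_of_publishedSignedInputs_of_analyticRank_le_one
    (hBSTW : BurungaleSkinnerTianWan2024_thm13_twist_OPEN)
    (hPub : Summit.BirchSwinnertonDyer.BirchSwinnertonDyer.Theses.SignedLowerHalves.PublishedSignedInputs)
    (W₀ : WeierstrassCurve ℚ) [W₀.IsElliptic] [W₀.IsGloballyMinimal]
    (K : Type) [Field K] [NumberField K] (hK : Module.finrank ℚ K = 2) (hsst : Semistable W₀)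
    (W : WeierstrassCurve ℚ) [W.IsElliptic] [W.IsGloballyMinimal] (p : ℕ) [Fact p.Prime]
    (hcop : IsCoprime (NumberField.discr K) ((W₀.conductorNorm ℤ * p : ℕ) : ℤ))
    (hord : ∀ (ℓ : ℕ) [Fact ℓ.Prime], (ℓ : ℤ) ∣ NumberField.discr K → GoodOrd W₀ ℓ)
    (hWd : ∃ C : VariableChange ℚ, C • W₀.quadraticTwist (NumberField.discr K : ℚ) = W)
    (hp : p ≠ 2) (hX : ClassX7 W p) (hap : W.frobeniusTrace p = 0) (hs : Surj W p)
    (hr : W.analyticRank ≤ 1) : BSDp W p := by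
  have hcop' : IsCoprime (NumberField.discr K) ((W₀.conductorNorm ℤ : ℤ) * p) := by
    simpa only [Nat.cast_mul] using hcop
  obtain ⟨hG₀, hap₀⟩ :=
    goodSS_and_frobeniusTrace_eq_zero_of_twistOfSemistable W₀ W p hp K hK hcop' hWd hX.1 hap
  have h4 : p = 3 → W₀.frobeniusTrace 3 = 0 := by
    intro h3
    subst h3
    exact hap₀
  have hlow : KobayashiLowerDivisibility W p 1 :=
    kobayashiLowerDivisibility_of_BSTW13_twist_OPEN W₀ p hBSTW hp hsst hG₀ h4 K hK hcop hord W hWd 1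
  unfold Summit.BirchSwinnertonDyer.BirchSwinnertonDyer.Theses.SignedLowerHalves.PublishedSignedInputs
    at hPub
  obtain ⟨hW, h12, h41, hKim, hA5, h5, h3, hmodP, hmod, hGZK⟩ := hPub
  exact X7.bsdp_of_lowerDivisibility_of_surj W p hW h12 h41 hKim hA5 h5 h3 hmodP hmod hGZK hp hX hap hs
    hr 1 hlow

end Summit.BirchSwinnertonDyer.BirchSwinnertonDyer.Theorems

end
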